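import Summits.HubbardSuperconductivity.HubbardSuperconductivity.Theorems.DeformationLadderLadderThesisPinnedFrameDefs
import Literature.MathematicalPhysics.QuantumLattice.BdGBondHamiltonianTorus
import Literature.MathematicalPhysics.QuantumLattice.ApproximateEigenvectorLemmas
import HarnessLib

/-!
# Pinned spin-↑ gauge frame for `LadderThesis` (stmt-HubbardSuperconductivity-1890) — the exact
# flat-gauge covariance of the zero-mode pair penalty and the orbit sum rule

First lemma of the crux idea `pinned-up-gauge-frame` and its companions (a)–(c), proved:

* `fockTwist_conj_pairPenalty` (**Covariance**, the card's FIRST LEMMA): for an even form factor,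
  `D_k (Δ_gᴴΔ_g) D_k⁻¹ = Δ↑_g(k)ᴴ Δ↑_g(k)` with `D_k = fockTwist (upTwistAngle L k)` — the `L²`
  pair-momentum penalties are ONE orbit of the crux's zero-mode penalty under sector-preserving
  diagonal unitaries (`fockTwist_conj_pairField`: `D_k Δ_g D_k⁻¹ = Δ↑_g(k)`, the Fulde–Ferrell boost);
  `fockTwist_upTwistAngle_neg`: `D_{-k} = D_k⁻¹`.
* `upPairFieldAt_zero_eq_pairField` (**PairFieldAtZero**): `Δ↑_g(0) = Δ_g` (CAR re-indexing);
* `sum_conjTranspose_upPairFieldAt_mul_self` (**OrbitSumRule**): `Σ_k Δ↑_g(k)ᴴΔ↑_g(k) = 2L² Σ_x Q_xᴴQ_x`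
  (operator Plancherel), whence the whole orbit carries total penalty `≤ 32 L⁴` on a unit vector
  (`sum_re_expect_upPenalty_dWave_le`): `Σ_k ⟨Π_k⟩_ψ ≤ 32` for `Π_k = L⁻⁴ Δ↑_d(k)ᴴΔ↑_d(k)`.

All statements are finite-dimensional operator algebra on the literal route objects
(`hubbardTorus`, `pairField dWaveFormFactor`, `fockTwist`, `torusChar`); interface statements are
instance-free (no operator identity `D D⁻¹ = 1`: the two `DecidableEq (Orb (FermionTorus 2 L))`
instances are not definitionally equal, cf. `HubbardLSMFillingProofs`).
References: Fulde–Ferrell, Phys. Rev. 135 (1964) A550; Lieb–Schultz–Mattis, Ann. Phys. 16 (1961) 407,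
App. B; Kennedy–Lieb–Shastry, PRL 61 (1988) 2582 (sum rule); Scalapino, Phys. Rep. 250 (1995) 329, §2.
-/

noncomputable section

namespace Summit.HubbardSuperconductivity.HubbardSuperconductivity.Theorems.PinnedFrame

set_option linter.dupNamespace false

open Matrix Finset Complex Literature.MathematicalPhysics.QuantumLattice
  Literature.Probability.LatticeModels HubbardWave0
open scoped ComplexOrder ComplexConjugate Matrix.Norms.L2Operator

variable (g : Site 2 → ℝ) (L : ℕ) [NeZero L]

/-! ### The opposite frame is the frame of winding `-k` -/

/-- The twist phase of the spin-↑ orbital at `x` is the character: `exp(i θ_k(x,↑)) = χ_k(x)`. [folklore] -/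
theorem cexp_upTwistAngle_orb_up (k x : TorusSite 2 L) :
    cexp ((upTwistAngle L k (orb (FermionTorus.ofTorusSite x) 0) : ℂ) * I) = torusChar k x := by
  rw [upTwistAngle_orb_up, torusChar_eq_cexp]

/-- Orbital by orbital, the twist phases of winding `-k` are the inverse twist phases of winding
`k`: `exp(i θ_{-k}(o)) = exp(-i θ_k(o))` (the angles differ by a multiple of `2π`). [folklore] -/
theorem cexp_upTwistAngle_neg (k : TorusSite 2 L) (o : Orb (FermionTorus 2 L)) :
    cexp ((upTwistAngle L (-k) o : ℂ) * I) = cexp (((-upTwistAngle L k) o : ℂ) * I) := by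
  -- write `o = (y, σ)` and `y = ofTorusSite x`
  have ho : o = orb (FermionTorus.ofTorusSite (FermionTorus.toTorusSite (ofLex o).1)) (ofLex o).2 := by
    rw [FermionTorus.ofTorusSite_toTorusSite]; rfl
  set x := FermionTorus.toTorusSite (ofLex o).1
  rw [ho, Pi.neg_apply]
  rcases Fin.exists_fin_two.mp ⟨(ofLex o).2, rfl⟩ with h | h <;> rw [h]
  · rw [cexp_upTwistAngle_orb_up, Complex.ofReal_neg, neg_mul, cexp_neg_upTwistAngle_orb_up,
      torusChar_comm, torusChar_neg_right, torusChar_comm]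
  · rw [upTwistAngle_orb_down, upTwistAngle_orb_down, neg_zero]

/-- **The inverse boost is the boost of opposite winding**: `D_{-k} = D_k⁻¹`, i.e.
`fockTwist (upTwistAngle L (-k)) = fockTwist (-upTwistAngle L k)` as operators (their angle
functions differ orbitalwise by multiples of `2π`). [folklore] -/
theorem fockTwist_upTwistAngle_neg (k : TorusSite 2 L) :
    fockTwist (upTwistAngle L (-k)) = fockTwist (-upTwistAngle L k) := by
  rw [fockTwist, fockTwist]
  congr 1
  funext s
  have hexp : ∀ θ : Orb (FermionTorus 2 L) → ℝ,
      cexp (((∑ i ∈ s, θ i : ℝ) : ℂ) * I) = ∏ i ∈ s, cexp ((θ i : ℂ) * I) := by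
    intro θ
    rw [← Complex.exp_sum]
    push_cast
    rw [Finset.sum_mul]
  rw [hexp, hexp]
  exact Finset.prod_congr rfl fun o _ => cexp_upTwistAngle_neg L k o

/-! ### Conjugating fermion operators by the flat spin-↑ twist -/

/-- **`D_k c_{x↑} D_k⁻¹ = conj χ_k(x) • c_{x↑}`** (`D_k = fockTwist (upTwistAngle L k)`).
Lieb–Schultz–Mattis (1961), App. B. [folklore] -/
theorem fockTwist_conj_annihilation_up (k x : TorusSite 2 L) :
    fockTwist (upTwistAngle L k) * annihilation (orb (FermionTorus.ofTorusSite x) 0) *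
        fockTwist (-upTwistAngle L k) =
      conj (torusChar k x) • annihilation (orb (FermionTorus.ofTorusSite x) 0) := by
  rw [fockTwist_mul_annihilation_mul, cexp_neg_upTwistAngle_orb_up]

omit [NeZero L] in
/-- **`D_k c_{y↓} D_k⁻¹ = c_{y↓}`**: the spin-↓ fermions are not twisted. [folklore] -/
theorem fockTwist_conj_annihilation_down (k : TorusSite 2 L) (y : FermionTorus 2 L) :
    fockTwist (upTwistAngle L k) * annihilation (orb y 1) * fockTwist (-upTwistAngle L k) =
      annihilation (orb y 1) := by
  rw [fockTwist_mul_annihilation_mul, upTwistAngle_orb_down, Complex.ofReal_zero, zero_mul,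
    neg_zero, Complex.exp_zero, one_smul]

/-- **`D_k Q_x D_k⁻¹ = conj χ_k(x) • Q_x`**: the ↑-based bond pair at `x` picks up exactly the
phase of its ↑ site. [folklore] -/
theorem fockTwist_conj_upPair (k x : TorusSite 2 L) :
    fockTwist (upTwistAngle L k) * upPair g L x * fockTwist (-upTwistAngle L k) =
      conj (torusChar k x) • upPair g L x := by
  unfold upPair
  simp only [Finset.mul_sum, Finset.sum_mul, Matrix.mul_smul, Matrix.smul_mul, Finset.smul_sum]
  refine Finset.sum_congr rfl fun e _ => ?_
  rw [fockTwist_conj_mul, fockTwist_conj_annihilation_up, fockTwist_conj_annihilation_down,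
    Matrix.smul_mul, smul_comm]

/-- **`D_k (Σ_x Q_x) D_k⁻¹ = Σ_x conj χ_k(x) • Q_x`.** [folklore] -/
theorem fockTwist_conj_sum_upPair (k : TorusSite 2 L) :
    fockTwist (upTwistAngle L k) * (∑ x : TorusSite 2 L, upPair g L x) *
        fockTwist (-upTwistAngle L k) =
      ∑ x : TorusSite 2 L, conj (torusChar k x) • upPair g L x := by
  simp only [Finset.mul_sum, Finset.sum_mul, fockTwist_conj_upPair]

/-! ### The zero mode: the singlet pair field in the spin-↑ convention -/

omit [NeZero L] in
/-- The five pair steps `{0, ±e₁, ±e₂}` are closed under `e ↦ -e`. [folklore] -/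
theorem neg_mem_insert_unitSteps {e : Site 2} (he : e ∈ insert (0 : Site 2) unitSteps) :
    -e ∈ insert (0 : Site 2) unitSteps := by
  simp only [unitSteps, Finset.mem_insert, Finset.mem_singleton] at he ⊢
  rcases he with rfl | rfl | rfl | rfl | rfl <;> simp

omit [NeZero L] in
/-- Re-indexing a sum over the pair steps by `e ↦ -e`. [folklore] -/
theorem sum_insert_unitSteps_comp_neg {M : Type*} [AddCommMonoid M] (F : Site 2 → M) :
    ∑ e ∈ insert (0 : Site 2) unitSteps, F (-e) = ∑ e ∈ insert (0 : Site 2) unitSteps, F e :=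
  Finset.sum_nbij' (fun e => -e) (fun e => -e) (fun _ he => neg_mem_insert_unitSteps he)
    (fun _ he => neg_mem_insert_unitSteps he) (fun _ _ => neg_neg _) (fun _ _ => neg_neg _)
    (fun _ _ => rfl)

/-- **The singlet pair field in the spin-↑ convention.** For a form factor `g` even on the pair
steps, `pairField g L = √2 • Σ_x Q_x`, `Q_x = Σ_e g(e) c_{x↑}c_{x+e,↓}`: the `c_{x↓}c_{x+e,↑}` half of
each singlet bond pair is, by the CAR and the re-indexing `x ↦ x + e`, `e ↦ -e`, the
`c_{x↑}c_{x+e,↓}` half once more. Scalapino, Phys. Rep. 250 (1995) 329, §2, eqs. (2.2)–(2.3). [folklore] -/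
theorem pairField_eq_sqrt_two_smul_sum_upPair
    (hg : ∀ e ∈ insert (0 : Site 2) unitSteps, g (-e) = g e) :
    pairField g L = ((Real.sqrt 2 : ℝ) : ℂ) • ∑ x : TorusSite 2 L, upPair g L x := by
  have hanti : ∀ a b : Orb (FermionTorus 2 L), annihilation a * annihilation b =
      -(annihilation b * annihilation a :
        Matrix (Finset (Orb (FermionTorus 2 L))) (Finset (Orb (FermionTorus 2 L))) ℂ) :=
    fun a b => eq_neg_of_add_eq_zero_left (annihilation_anticommute_holds a b)
  -- the `↓↑` half, bond by bond, read from the far end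
  have step1 : ∀ e : Site 2,
      ∑ x : TorusSite 2 L, annihilation (orb (FermionTorus.ofTorusSite x) 1) *
          annihilation (orb (FermionTorus.ofTorusSite (x + Torus.proj L e)) 0) =
      -∑ x : TorusSite 2 L, (annihilation (orb (FermionTorus.ofTorusSite x) 0) *
          annihilation (orb (FermionTorus.ofTorusSite (x - Torus.proj L e)) 1) :
            Matrix (Finset (Orb (FermionTorus 2 L))) (Finset (Orb (FermionTorus 2 L))) ℂ) := by
    intro e
    rw [← Finset.sum_neg_distrib, TorusSite.sum_sub_shift (Torus.proj L e) (fun a b =>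
      -(annihilation (orb (FermionTorus.ofTorusSite a) 0) *
        annihilation (orb (FermionTorus.ofTorusSite b) 1) :
          Matrix (Finset (Orb (FermionTorus 2 L))) (Finset (Orb (FermionTorus 2 L))) ℂ))]
    exact Finset.sum_congr rfl fun x _ => hanti _ _
  -- summed over the (negation-closed) steps with the even weight, it is minus the `↑↓` half
  have step2 : ∑ e ∈ insert (0 : Site 2) unitSteps, ((g e / Real.sqrt 2 : ℝ) : ℂ) •
        ∑ x : TorusSite 2 L, annihilation (orb (FermionTorus.ofTorusSite x) 1) *
          annihilation (orb (FermionTorus.ofTorusSite (x + Torus.proj L e)) 0) =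
      -∑ e ∈ insert (0 : Site 2) unitSteps, ((g e / Real.sqrt 2 : ℝ) : ℂ) •
        ∑ x : TorusSite 2 L, annihilation (orb (FermionTorus.ofTorusSite x) 0) *
          annihilation (orb (FermionTorus.ofTorusSite (x + Torus.proj L e)) 1) := by
    simp_rw [step1, smul_neg, Finset.sum_neg_distrib]
    rw [neg_inj, ← sum_insert_unitSteps_comp_neg]
    refine Finset.sum_congr rfl fun e he => ?_
    simp only [hg e he, Torus.proj_neg, sub_neg_eq_add]
  -- assemble
  have hsq : ((Real.sqrt 2 : ℝ) : ℂ) * ((Real.sqrt 2 : ℝ) : ℂ) = 2 := by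
    rw [← Complex.ofReal_mul, Real.mul_self_sqrt two_pos.le]; norm_num
  have h2 : ((Real.sqrt 2 : ℝ) : ℂ) ≠ 0 := by exact_mod_cast Real.sqrt_ne_zero'.2 two_pos
  unfold pairField localPair upPair
  simp only [smul_sub, Finset.sum_sub_distrib]
  rw [Finset.sum_comm, Finset.sum_comm (f := fun (x : TorusSite 2 L) (e : Site 2) =>
    ((g e / Real.sqrt 2 : ℝ) : ℂ) • (annihilation (orb (FermionTorus.ofTorusSite x) 1) *
      annihilation (orb (FermionTorus.ofTorusSite (x + Torus.proj L e)) 0)))]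
  simp only [← Finset.smul_sum]
  rw [step2, sub_neg_eq_add, ← two_smul ℂ]
  simp only [Finset.smul_sum, smul_smul]
  rw [Finset.sum_comm]
  refine Finset.sum_congr rfl fun x _ => Finset.sum_congr rfl fun e _ => ?_
  refine congrFun (congrArg HSMul.hSMul ?_) _
  push_cast
  field_simp
  linear_combination (-((g e : ℝ) : ℂ)) * hsq

/-- At zero momentum the spin-↑-convention pair field is `√2 Σ_x Q_x`. [folklore] -/
theorem upPairFieldAt_zero :
    upPairFieldAt g L 0 = ((Real.sqrt 2 : ℝ) : ℂ) • ∑ x : TorusSite 2 L, upPair g L x := by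
  simp [upPairFieldAt]

/-- **`Δ↑_g(0) = Δ_g`**: for an even form factor the zero mode of the spin-↑-convention pair field
is the tree's singlet pair field `pairField g L`. Scalapino, Phys. Rep. 250 (1995) 329, §2. [folklore] -/
theorem upPairFieldAt_zero_eq_pairField (hg : ∀ e ∈ insert (0 : Site 2) unitSteps, g (-e) = g e) :
    upPairFieldAt g L 0 = pairField g L := by
  rw [upPairFieldAt_zero, pairField_eq_sqrt_two_smul_sum_upPair g L hg]

/-- **`Δ↑_d(0) = Δ_d`** for the `d_{x²-y²}` form factor (which is even, `dWaveFormFactor_neg`). [folklore] -/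
theorem upPairFieldAt_dWave_zero :
    upPairFieldAt dWaveFormFactor L 0 = pairField dWaveFormFactor L :=
  upPairFieldAt_zero_eq_pairField _ L fun e _ => dWaveFormFactor_neg e

/-! ### Exact flat-gauge covariance of the pair field and of the zero-mode penalty -/

omit [NeZero L] in
/-- Conjugating an adjoint by the twist: `D Xᴴ D⁻¹ = (D X D⁻¹)ᴴ` (`D⁻¹ = Dᴴ`). [folklore] -/
theorem fockTwist_conj_conjTranspose (θ : Orb (FermionTorus 2 L) → ℝ)
    (X : Matrix (Finset (Orb (FermionTorus 2 L))) (Finset (Orb (FermionTorus 2 L))) ℂ) :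
    fockTwist θ * Xᴴ * fockTwist (-θ) = (fockTwist θ * X * fockTwist (-θ))ᴴ := by
  rw [conjTranspose_mul, conjTranspose_mul, conjTranspose_fockTwist, conjTranspose_fockTwist, neg_neg,
    Matrix.mul_assoc]

/-- **Covariance of the pair field (Fulde–Ferrell boost).** For an even form factor,
`D_k Δ_g D_k⁻¹ = Δ↑_g(k)`: the flat spin-↑ twist of winding `k` carries the zero-momentum singlet
pair field EXACTLY to the momentum-`k` pair field in the spin-↑ convention.
Fulde–Ferrell, Phys. Rev. 135 (1964) A550; Lieb–Schultz–Mattis (1961), App. B. [folklore] -/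
theorem fockTwist_conj_pairField (hg : ∀ e ∈ insert (0 : Site 2) unitSteps, g (-e) = g e)
    (k : TorusSite 2 L) :
    fockTwist (upTwistAngle L k) * pairField g L * fockTwist (-upTwistAngle L k) =
      upPairFieldAt g L k := by
  rw [pairField_eq_sqrt_two_smul_sum_upPair g L hg, Matrix.mul_smul, Matrix.smul_mul,
    fockTwist_conj_sum_upPair]
  rfl

/-- **Covariance of the zero-mode pair penalty (first lemma of the card `pinned-up-gauge-frame`).**
For an even form factor, `D_k (Δ_gᴴ Δ_g) D_k⁻¹ = Δ↑_g(k)ᴴ Δ↑_g(k)`: the `L²` momentum penalties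
are ONE orbit of the zero-mode penalty under the sector-preserving flat spin-↑ twists.
Fulde–Ferrell, Phys. Rev. 135 (1964) A550. [folklore] -/
theorem fockTwist_conj_pairPenalty (hg : ∀ e ∈ insert (0 : Site 2) unitSteps, g (-e) = g e)
    (k : TorusSite 2 L) :
    fockTwist (upTwistAngle L k) * ((pairField g L)ᴴ * pairField g L) *
        fockTwist (-upTwistAngle L k) =
      (upPairFieldAt g L k)ᴴ * upPairFieldAt g L k := by
  rw [fockTwist_conj_mul, fockTwist_conj_conjTranspose, fockTwist_conj_pairField g L hg]

/-- Covariance of the `d_{x²-y²}` pair field: `D_k Δ_d D_k⁻¹ = Δ↑_d(k)`. [folklore] -/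
theorem fockTwist_conj_pairField_dWave (k : TorusSite 2 L) :
    fockTwist (upTwistAngle L k) * pairField dWaveFormFactor L * fockTwist (-upTwistAngle L k) =
      upPairFieldAt dWaveFormFactor L k :=
  fockTwist_conj_pairField _ L (fun e _ => dWaveFormFactor_neg e) k

/-- Covariance of the `d_{x²-y²}` zero-mode penalty: `D_k (Δ_dᴴ Δ_d) D_k⁻¹ = Δ↑_d(k)ᴴ Δ↑_d(k)`.
[folklore] -/
theorem fockTwist_conj_pairPenalty_dWave (k : TorusSite 2 L) :
    fockTwist (upTwistAngle L k) * ((pairField dWaveFormFactor L)ᴴ * pairField dWaveFormFactor L) *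
        fockTwist (-upTwistAngle L k) =
      (upPairFieldAt dWaveFormFactor L k)ᴴ * upPairFieldAt dWaveFormFactor L k :=
  fockTwist_conj_pairPenalty _ L (fun e _ => dWaveFormFactor_neg e) k

/-! ### The orbit sum rule -/

/-- `Δ↑_g(k)ᴴ Δ↑_g(k) = 2 • A(k)ᴴ A(k)` with `A(k) = Σ_x conj χ_k(x) • Q_x`. [folklore] -/
theorem conjTranspose_upPairFieldAt_mul_self (k : TorusSite 2 L) :
    (upPairFieldAt g L k)ᴴ * upPairFieldAt g L k =
      (2 : ℂ) • ((∑ x : TorusSite 2 L, conj (torusChar k x) • upPair g L x)ᴴ *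
        ∑ x : TorusSite 2 L, conj (torusChar k x) • upPair g L x) := by
  have hsq : star ((Real.sqrt 2 : ℝ) : ℂ) * ((Real.sqrt 2 : ℝ) : ℂ) = 2 := by
    rw [Complex.star_def, Complex.conj_ofReal, ← Complex.ofReal_mul, Real.mul_self_sqrt two_pos.le]
    norm_num
  unfold upPairFieldAt
  rw [conjTranspose_smul, Matrix.smul_mul, Matrix.mul_smul, smul_smul, hsq]

/-- **Orbit sum rule (discrete Plancherel).** `Σ_k Δ↑_g(k)ᴴ Δ↑_g(k) = 2L² • Σ_x Q_xᴴ Q_x`: the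
orbit sum of the penalty is `L²` times a LOCAL positive operator (the spin-↑-convention pair
number), by the tree's operator Plancherel `sum_conjTranspose_mul_fourierMode`.
Kennedy–Lieb–Shastry, PRL 61 (1988) 2582 (sum rule). [folklore] -/
theorem sum_conjTranspose_upPairFieldAt_mul_self :
    ∑ k : TorusSite 2 L, (upPairFieldAt g L k)ᴴ * upPairFieldAt g L k =
      (2 * (L : ℂ) ^ 2) • ∑ x : TorusSite 2 L, (upPair g L x)ᴴ * upPair g L x := by
  simp_rw [conjTranspose_upPairFieldAt_mul_self, ← Finset.smul_sum,
    sum_conjTranspose_mul_fourierMode (upPair g L), smul_smul]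

/-- **Orbit sum rule, vector form**: `Σ_k ‖Δ↑_g(k) ψ‖² = 2L² Σ_x ‖Q_x ψ‖²` (as `dotProduct`s). [folklore] -/
theorem sum_star_upPairFieldAt_mulVec_dotProduct (ψ : Fock (Orb (FermionTorus 2 L))) :
    ∑ k : TorusSite 2 L, star (upPairFieldAt g L k *ᵥ ψ) ⬝ᵥ (upPairFieldAt g L k *ᵥ ψ) =
      (2 * (L : ℂ) ^ 2) * ∑ x : TorusSite 2 L, star (upPair g L x *ᵥ ψ) ⬝ᵥ (upPair g L x *ᵥ ψ) := by
  have h := congrArg (fun T => star ψ ⬝ᵥ (T *ᵥ ψ)) (sum_conjTranspose_upPairFieldAt_mul_self g L)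
  simp only [sum_mulVec, dotProduct_sum, smul_mulVec, dotProduct_smul, smul_eq_mul] at h
  simp_rw [Literature.MathematicalPhysics.QuantumLattice.star_mulVec_dotProduct_mulVec]
  exact h

/-! ### A priori bounds: the whole orbit carries `O(1)` penalty -/

omit [NeZero L] in
/-- `‖c_a c_b‖ ≤ 1` in operator norm (generic in the lattice, as `norm_bondPair_le_two`). [folklore] -/
theorem norm_annihilation_mul_annihilation_le_one {Λ : Type*} [LinearOrder Λ] [Fintype Λ] (a b : Orb Λ) :
    ‖(annihilation a * annihilation b : Matrix (Finset (Orb Λ)) (Finset (Orb Λ)) ℂ)‖ ≤ 1 :=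
  (norm_mul_le _ _).trans
    (mul_le_one₀ (norm_annihilation_le_one _) (norm_nonneg _) (norm_annihilation_le_one _))

/-- `‖Q_x‖ ≤ Σ_e |g(e)|` (`‖c c‖ ≤ 1`). [folklore] -/
theorem norm_upPair_le (x : TorusSite 2 L) :
    ‖upPair g L x‖ ≤ ∑ e ∈ insert (0 : Site 2) unitSteps, |g e| := by
  rw [upPair]
  refine (norm_sum_le _ _).trans (Finset.sum_le_sum fun e _ => ?_)
  rw [norm_smul, Complex.norm_real, Real.norm_eq_abs]
  exact mul_le_of_le_one_right (abs_nonneg _) (norm_annihilation_mul_annihilation_le_one _ _)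

/-- For the `d_{x²-y²}` form factor, `Σ_e |g(e)| = 4`. [folklore] -/
theorem sum_abs_dWaveFormFactor : ∑ e ∈ insert (0 : Site 2) unitSteps, |dWaveFormFactor e| = 4 := by
  rw [Finset.sum_insert zero_not_mem_unitSteps, sum_unitSteps]
  simp only [dWaveFormFactor_zero, abs_zero, zero_add, dWaveFormFactor_unitStep,
    dWaveFormFactor_neg_unitStep, Fin.isValue, if_true, one_ne_zero, if_false, abs_one, abs_neg]
  norm_num

/-- `‖Q_x‖ ≤ 4` for the `d_{x²-y²}` form factor. [folklore] -/
theorem norm_upPair_dWave_le (x : TorusSite 2 L) : ‖upPair dWaveFormFactor L x‖ ≤ 4 :=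
  (norm_upPair_le _ L x).trans (le_of_eq sum_abs_dWaveFormFactor)

/-- **The orbit carries total penalty `O(L⁴)`**: for a unit vector `ψ`,
`Σ_k Re⟨ψ, Δ↑_d(k)ᴴ Δ↑_d(k) ψ⟩ ≤ 32 L⁴` (sum rule + `‖Q_x ψ‖ ≤ 4`), i.e. `Σ_k ⟨Π_k⟩_ψ ≤ 32` for the
normalised penalties `Π_k = L⁻⁴ Δ↑_d(k)ᴴ Δ↑_d(k)`. [folklore] -/
theorem sum_re_expect_upPenalty_dWave_le {ψ : Fock (Orb (FermionTorus 2 L))} (hψ : star ψ ⬝ᵥ ψ = 1) :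
    ∑ k : TorusSite 2 L, (star ψ ⬝ᵥ (((upPairFieldAt dWaveFormFactor L k)ᴴ *
        upPairFieldAt dWaveFormFactor L k) *ᵥ ψ)).re ≤ 32 * (L : ℝ) ^ 4 := by
  have hx : ∀ x : TorusSite 2 L,
      (star (upPair dWaveFormFactor L x *ᵥ ψ) ⬝ᵥ (upPair dWaveFormFactor L x *ᵥ ψ)).re ≤ 16 := by
    intro x
    rw [← eucNorm_sq]
    have h1 : eucNorm (upPair dWaveFormFactor L x *ᵥ ψ) ≤ 4 := by
      have h := eucNorm_mulVec_le (upPair dWaveFormFactor L x) ψ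
      rw [eucNorm_eq_one hψ, mul_one] at h
      exact h.trans (norm_upPair_dWave_le L x)
    nlinarith [eucNorm_nonneg (upPair dWaveFormFactor L x *ᵥ ψ)]
  have hsum := sum_star_upPairFieldAt_mulVec_dotProduct dWaveFormFactor L ψ
  simp_rw [← Literature.MathematicalPhysics.QuantumLattice.star_mulVec_dotProduct_mulVec]
  rw [← Complex.re_sum, hsum, show (2 * (L : ℂ) ^ 2) = ((2 * (L : ℝ) ^ 2 : ℝ) : ℂ) by push_cast; ring,
    Complex.re_ofReal_mul, Complex.re_sum]
  calc 2 * (L : ℝ) ^ 2 * ∑ x : TorusSite 2 L,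
        (star (upPair dWaveFormFactor L x *ᵥ ψ) ⬝ᵥ (upPair dWaveFormFactor L x *ᵥ ψ)).re
      ≤ 2 * (L : ℝ) ^ 2 * ∑ _x : TorusSite 2 L, (16 : ℝ) := by
        gcongr with x _
        exact hx x
    _ = 32 * (L : ℝ) ^ 4 := by
        rw [Finset.sum_const, Finset.card_univ, nsmul_eq_mul]
        simp only [Fintype.card_pi, ZMod.card, Finset.prod_const, Finset.card_univ, Fintype.card_fin,
          Nat.cast_pow]
        ring

end Summit.HubbardSuperconductivity.HubbardSuperconductivity.Theorems.PinnedFrame
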